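import Summits.BirchSwinnertonDyer.BirchSwinnertonDyer.Theorems.SignedBaseChangeAnticyclotomicEisensteinDivisibilityAdmdefKolyvaginRoot
import Summits.BirchSwinnertonDyer.BirchSwinnertonDyer.Theorems.SignedBaseChangeAnticyclotomicEisensteinDivisibilityAdmdefTamagawaOfAllRamified
import HarnessLib

/-!
# Line `admdef` (crux `AnticyclotomicEisensteinDivisibility`, stmt-BirchSwinnertonDyer-20727), rigidity road: TORIC ⟹ ORDINARY at an admissible prime
# (the converse of LEAD g28's `…AdmdefLayerZeroDictionary` §4), hence the reading `ord-via-Frobenius` of CHKLL25 as a kernel EQUIVALENCE, and the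
# LEVEL-`n` DICTIONARY `T X ∈ Sel^ε_n(K_0, E[p]) ⟺ (Kummer off n) ∧ (toric at n)` between CHKLL25's bottom signed Selmer groups and the tree's
# `H¹(K, E[p])` with W. Zhang's local conditions

LEAD seat bsd-line-sbc-p1 (gen 32), `--supports stmt-BirchSwinnertonDyer-20727` (helper; OFF the v24 composition path; the «level-`n` dictionary» input of
Howard's rigidity theorem on cell β, memo `Lines/admdef-lead-g31.md` §3 — the bridge between the AKR currency `SelQP` of the anchor (K1) and the
CHKLL25 currency `signedOrdSelmerTorsion` of the signed bipartite system).  `T = resH1Hom (Γ_{K_0} ↪ Γ_K)` is onto and injective (g28).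

* §1 two generic cocycle lemmas on `H¹(Γ_K, E[p])`: `apply_eq_of_mem_zpowers_of_apply_eq` (a cocycle that is the coboundary `∂b` AT `φ` is `∂b` on all
  of `⟨φ⟩`) and `apply_conj_eq_of_apply_eq` (if `ψ φ₁ = ∂a (φ₁)` then `ψ (τ φ₁ τ⁻¹) = ∂(τ a − ψ τ) (τ φ₁ τ⁻¹)`).
* §2 `exists_apply_eq_coboundary_of_mem_toricLocalKer` — at the prime `𝔓₁ = 𝔓_{ι₀,𝔐}` of a good `v ∤ p`: a TORIC class (AKR `toricLocalKer`, cocycle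
  valued in the augmentation line up to a coboundary; criterion `ToricFrob.oneCocycleClass_mem_toricLocalKer_iff` + `closure_decomposition_eq_range`:
  the augmentation subgroup of `D_{𝔓₁}` is `(F − 1)E[p]`) takes at every arithmetic Frobenius `φ₁ ∈ D_{𝔓₁}` a COBOUNDARY value `φ₁ a − a`
  (`φ₁ F⁻¹ ∈ I_{𝔓₁}` fixes `E[p]`, Mathlib `IsArithFrobAt.mul_inv_mem_inertia`).
* §3 ★ `forall_mem_ordinaryAt_of_mem_toricLocalKer` — TORIC at `v ∋ q` (`q` Bertolini–Darmon admissible) ⟹ `T X` is `ordinaryAt 𝔓` for EVERY `𝔓 ∣ v`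
  (conjugate the Frobenius back to `𝔓₁`, Mathlib `IsArithFrobAt.conj`; §1); with g28's converse: `forall_mem_ordinaryAt_iff_mem_toricLocalKer`.
* §4 ★★ `resH1Hom_layerZero_mem_signedOrdSelmerTorsion_iff` — THE LEVEL-`n` DICTIONARY on cell β: under `AcSigned.Setting`, (Heeg) for `N_E`, the named
  print fact {HLV 2022 Lemma 3.7, local form} and (KU) at the bad places (`hbad`, discharged on the all-ramified cell by g29–g30:
  `…_of_allRamified`), for a finite set `s` of admissible primes and `X ∈ H¹(K, E[p])`:
  `T X ∈ Sel^ε_{∏s}(K_0, E[p]) ⟺ (∀ v ∌ every q ∈ s, X Kummer at v) ∧ (∀ q ∈ s, ∀ v ∋ q, X toric at v)` — at `s = ∅` this is g29's rank-one dictionary.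

HONEST FRAMING: theorems only (0 definitions, 0 named facts introduced, 0 `sorry`; standard axioms); §4 is CONDITIONAL on the displayed named fact
(audit `proof.conditional`); nothing about the crux, the anchors (K1 = item stmt-BirchSwinnertonDyer-33118) or BSD is asserted; no summit statement
is proved.

References: [cite: Howard2006, §2.2, Lem. 2.2.1, §3.1] [cite: CastellaEtAl2025, §7.2 (arXiv:2308.10474v2 p0030 L16–L27)] [cite: BertoliniDarmon2005, §2.2–§2.3, Lemma 2.6]
[cite: GrossLMS1991, §7 (7.1)] [cite: NeukirchANT1999, Ch. I §9 (9.4)–(9.5)] [cite: SerreGaloisCohomology1997, I §2.4–2.5] [cite: HatleyLeiVigni2022, Lemma 3.7]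
-/

-- D-0017: single-problem summit, the namespace repeats the problem name by design.
set_option linter.dupNamespace false
set_option autoImplicit false

noncomputable section

open scoped Classical NumberField Pointwise

namespace Summit.BirchSwinnertonDyer.BirchSwinnertonDyer.Theorems.SignedBaseChangeAcDivAdmdefToricOrdinary

open CategoryTheory WeierstrassCurve NumberField IsDedekindDomain Field Module
open Literature.NumberTheory.EllipticCurves Literature.NumberTheory.GaloisRepresentations
open Literature.NumberTheory.EllipticCurves.CastellaHsuKunduLeeLiu2025
open Literature.NumberTheory.EllipticCurves.BertoliniDarmon2005
open Literature.NumberTheory.EllipticCurves.AcSigned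
open Summit.BirchSwinnertonDyer.BirchSwinnertonDyer.Theorems.AdditiveKoly
open Summit.BirchSwinnertonDyer.Rank1Residual.X11b.Three.Koly.Method2
open Summit.BirchSwinnertonDyer.BirchSwinnertonDyer.Theorems.SignedBaseChangeAcDivAdmdefCoreRootOfSeenAnchor
open Summit.BirchSwinnertonDyer.BirchSwinnertonDyer.Theorems.SignedBaseChangeAcDivAdmdefRootZero
open Summit.BirchSwinnertonDyer.BirchSwinnertonDyer.Theorems.SignedBaseChangeAcDivAdmdefSelmerBookkeeping
open Summit.BirchSwinnertonDyer.BirchSwinnertonDyer.Theorems.SignedBaseChangeAcDivAdmdefLayerZeroDictionary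
open Summit.BirchSwinnertonDyer.BirchSwinnertonDyer.Theorems.SignedBaseChangeAcDivAdmdefKolyvaginRoot
open Summit.BirchSwinnertonDyer.BirchSwinnertonDyer.Theorems.SignedBaseChangeAcDivAdmdefSignedControl
open Summit.BirchSwinnertonDyer.BirchSwinnertonDyer.Theorems.SignedBaseChangeAcDivAdmdefSignedControlEasy
open Summit.BirchSwinnertonDyer.BirchSwinnertonDyer.Theorems.SignedBaseChangeAcDivAdmdefRankOneDictionary
open Summit.BirchSwinnertonDyer.BirchSwinnertonDyer.Theorems.SignedBaseChangeAcDivAdmdefRankOneTamagawa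
open Summit.BirchSwinnertonDyer.BirchSwinnertonDyer.Theorems.SignedBaseChangeAcDivAdmdefTamagawaOfAllRamified
open scoped ContRepresentation

universe u

/-! ## §1 Two cocycle lemmas: a coboundary value at `φ` propagates to `⟨φ⟩`, and transports under conjugation -/

section Cocycles

variable {K : Type} [Field K] [NumberField K] (W : WeierstrassCurve ℚ) [W.IsElliptic] {p : ℕ} [Fact p.Prime]

omit [Fact p.Prime] in
/-- **A cocycle that agrees with the coboundary `∂b` at `φ` agrees with it on the whole of `⟨φ⟩`**: the zero set of the cocycle `ψ − ∂b` is a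
subgroup (`(ψ−∂b)(gh) = (ψ−∂b)(g) + g·(ψ−∂b)(h)`, `(ψ−∂b)(g⁻¹) = −g⁻¹·(ψ−∂b)(g)`), so it contains `Subgroup.zpowers φ`.
[cite: SerreGaloisCohomology1997, I §2.4–2.5] -/
theorem apply_eq_of_mem_zpowers_of_apply_eq
    (ψ : contOneCocycles (discreteTopRep (absoluteGaloisGroup K) (geomTorsion (W.baseChange K) ((p ^ 1 : ℕ) : ℤ))))
    {φ : absoluteGaloisGroup K} {b : geomTorsion (W.baseChange K) ((p ^ 1 : ℕ) : ℤ)} (hφ : ψ.1 φ = φ • b - b) :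
    ∀ s ∈ Subgroup.zpowers φ, ψ.1 s = s • b - b := by
  -- the cocycle `ψ' = ψ − ∂b`
  obtain ⟨ψ', -, hψ'⟩ := LocalFrob.exists_cocycle_sub_coboundary (W.baseChange K) ψ b
  -- its zero set is a subgroup
  let Z : Subgroup (absoluteGaloisGroup K) :=
    { carrier := {g | ψ'.1 g = 0}
      mul_mem' := fun {a c} ha hc ↦ by
        change ψ'.1 (a * c) = 0
        rw [ψ'.2 a c, discreteTopRep_ρ_apply]
        change ψ'.1 a = 0 at ha
        change ψ'.1 c = 0 at hc
        rw [ha, hc, smul_zero, add_zero]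
      one_mem' := contOneCocycles.apply_one ψ'
      inv_mem' := fun {a} ha ↦ by
        change ψ'.1 a⁻¹ = 0
        change ψ'.1 a = 0 at ha
        have h := ψ'.2 a⁻¹ a
        rw [inv_mul_cancel, contOneCocycles.apply_one, discreteTopRep_ρ_apply, ha, smul_zero, add_zero] at h
        exact h.symm }
  have hφZ : φ ∈ Z := by
    change ψ'.1 φ = 0
    rw [hψ' φ, hφ, sub_self]
  intro s hs
  have hsZ : s ∈ Z := (Subgroup.zpowers_le.mpr hφZ) hs
  change ψ'.1 s = 0 at hsZ
  rw [hψ' s] at hsZ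
  exact sub_eq_zero.mp hsZ

omit [W.IsElliptic] [Fact p.Prime] in
/-- **Transport of a coboundary value under conjugation**: if `ψ φ₁ = φ₁ a − a` then `ψ (τ φ₁ τ⁻¹) = (τ φ₁ τ⁻¹) b − b` with `b = τ a − ψ τ`
(cocycle identity twice and `ψ τ⁻¹ = −τ⁻¹ ψ τ`; the computation of LEAD g31's `…AdmdefKolyvaginRoot` §1 at a single element).
[cite: SerreGaloisCohomology1997, I §2.5] [cite: NeukirchANT1999, Ch. I §9 (9.5)] -/
theorem apply_conj_eq_of_apply_eq
    (ψ : contOneCocycles (discreteTopRep (absoluteGaloisGroup K) (geomTorsion (W.baseChange K) ((p ^ 1 : ℕ) : ℤ))))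
    {φ₁ τ : absoluteGaloisGroup K} {a : geomTorsion (W.baseChange K) ((p ^ 1 : ℕ) : ℤ)} (hφ₁ : ψ.1 φ₁ = φ₁ • a - a) :
    ψ.1 (τ * φ₁ * τ⁻¹) = (τ * φ₁ * τ⁻¹) • (τ • a - ψ.1 τ) - (τ • a - ψ.1 τ) := by
  -- adapted from Theorems/…AdmdefKolyvaginRoot.lean `resOfLe_resH1Hom_layerZero_eq_zero_of_localization_eq_zero` (step `hD`)
  have hinv : ψ.1 τ⁻¹ = -(τ⁻¹ • ψ.1 τ) := by
    have h := ψ.2 τ⁻¹ τ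
    rw [inv_mul_cancel, contOneCocycles.apply_one, discreteTopRep_ρ_apply] at h
    have h' : ψ.1 τ⁻¹ + τ⁻¹ • ψ.1 τ = 0 := h.symm
    exact eq_neg_of_add_eq_zero_left h'
  have e1 : (τ * φ₁ * τ⁻¹) • (τ • a) = τ • φ₁ • a := by
    rw [← mul_smul, inv_mul_cancel_right, mul_smul]
  have e3 : (τ * φ₁) • ψ.1 τ⁻¹ = -((τ * φ₁ * τ⁻¹) • ψ.1 τ) := by
    rw [hinv, smul_neg, ← mul_smul]
  rw [ψ.2 (τ * φ₁) τ⁻¹, discreteTopRep_ρ_apply, ψ.2 τ φ₁, discreteTopRep_ρ_apply, hφ₁, e3, smul_sub, smul_sub, e1]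
  abel

end Cocycles

/-! ## §2 A TORIC class takes a coboundary value at every Frobenius of the prime `𝔓₁ = 𝔓_{ι₀,𝔐}` -/

section Toric

variable {K : Type} [Field K] [NumberField K] (W : WeierstrassCurve ℚ) [W.IsElliptic] [W.IsGloballyMinimal] {p : ℕ} [Fact p.Prime]

omit [W.IsGloballyMinimal] in
/-- **At the prime `𝔓₁ = 𝔓_{ι₀,𝔐}` cut out by the embedding `K̄ → K̄_v` of a GOOD place `v ∤ p`: a class of `H¹(K, E[p])` that is TORIC at `K_v`
(`AdditiveKoly.toricLocalKer`) is, at every arithmetic Frobenius `φ₁ ∈ D_{𝔓₁}`, a coboundary value — `ψ φ₁ = φ₁ a − a`.**  By the toric criterion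
(`ToricFrob.oneCocycleClass_mem_toricLocalKer_iff`) `ψ d − (dP − P)` lies in the augmentation subgroup of `D_{𝔓₁}` for every `d ∈ D_{𝔓₁}`; that
subgroup is `(F − 1)E[p]` for any Frobenius `F` at `𝔓₁` (`ToricFrob.closure_decomposition_eq_range`, inertia fixing `E[p]`); and `φ₁` acts on `E[p]`
as `F` does (`φ₁F⁻¹ ∈ I_{𝔓₁}`, Mathlib `IsArithFrobAt.mul_inv_mem_inertia`), so `ψ φ₁ = (φ₁P − P) + (φ₁x − x)`.
[cite: BertoliniDarmon2005, §2.2–§2.3] [cite: Howard2006, Lem. 2.2.1 (proof)] [cite: NeukirchANT1999, Ch. I §9 (9.4)] -/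
theorem exists_apply_eq_coboundary_of_mem_toricLocalKer {v : HeightOneSpectrum (𝓞 K)} (hgood : (W.baseChange K).HasGoodReductionAt v)
    (hn : ((((p ^ 1 : ℕ) : ℤ)) : 𝓞 K) ∉ v.asIdeal)
    (ψ : contOneCocycles (discreteTopRep (absoluteGaloisGroup K) (geomTorsion (W.baseChange K) ((p ^ 1 : ℕ) : ℤ))))
    (htor : oneCocycleClass _ ψ ∈ toricLocalKer (W.baseChange K) (v.adicCompletion K) ((p ^ 1 : ℕ) : ℤ))
    {𝔐 : Ideal (HeightOneSpectrum.localAbsIntegers v)} (h𝔐 : 𝔐 ∈ v.localPrimesAbove)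
    {φ₁ : absoluteGaloisGroup K}
    (hφ₁ : IsArithFrobAt (𝓞 K) φ₁ (v.primeBelow (closureEmb (K := K) (v.adicCompletion K)) 𝔐)) :
    ∃ a : geomTorsion (W.baseChange K) ((p ^ 1 : ℕ) : ℤ), ψ.1 φ₁ = φ₁ • a - a := by
  -- adapted from Theorems/…AdmdefLayerZeroDictionary.lean `mem_toricLocalKer_of_forall_mem_ordinaryAt` (the converse direction)
  have hp : p.Prime := Fact.out
  have hn0 : p ^ 1 ≠ 0 := pow_ne_zero 1 hp.ne_zero
  have hnZ : (((p ^ 1 : ℕ) : ℤ)) ≠ 0 := by exact_mod_cast hn0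
  haveI : CharZero (v.adicCompletion K) :=
    charZero_of_injective_algebraMap (algebraMap K (v.adicCompletion K)).injective
  set 𝔓 := v.primeBelow (closureEmb (K := K) (v.adicCompletion K)) 𝔐 with h𝔓def
  have h𝔓 : 𝔓 ∈ v.primesAbove := v.primeBelow_mem_primesAbove h𝔐
  haveI : 𝔓.IsPrime := h𝔓.1
  have hφ₁D : φ₁ ∈ 𝔓.decompositionSubgroup (absoluteGaloisGroup K) := hφ₁.mem_stabilizer
  have hvbad : v ∉ (W.baseChange K).badPlaces (𝓞 K) := fun h ↦ h hgood
  have hI : 𝔓.inertia (absoluteGaloisGroup K) ≤ torsionFixing (W.baseChange K) (((p ^ 1 : ℕ) : ℤ)) :=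
    inertia_le_torsionFixing (W.baseChange K) hvbad hn _ h𝔐
  -- the toric criterion at `𝔓`, with the augmentation subgroup `= range (φ₁ − 1)` (φ₁ is itself a Frobenius at `𝔓`)
  obtain ⟨P, hP⟩ := (ToricFrob.oneCocycleClass_mem_toricLocalKer_iff (W.baseChange K) hn0 h𝔐 ψ).mp htor
  set g : geomTorsion (W.baseChange K) ((p ^ 1 : ℕ) : ℤ) →+ geomTorsion (W.baseChange K) ((p ^ 1 : ℕ) : ℤ) :=
    DistribSMul.toAddMonoidHom (geomTorsion (W.baseChange K) ((p ^ 1 : ℕ) : ℤ)) φ₁ - AddMonoidHom.id _ with hgdef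
  have hgapply : ∀ x, g x = φ₁ • x - x := fun _ ↦ rfl
  have hA := ToricFrob.closure_decomposition_eq_range (W.baseChange K) h𝔓 hnZ hφ₁ hI
  have hmem := hP φ₁ hφ₁D
  rw [hA] at hmem
  obtain ⟨x, hx⟩ := hmem
  refine ⟨P + x, ?_⟩
  rw [hgapply] at hx
  -- `ψ φ₁ − (φ₁ P − P) = φ₁ x − x`
  have h := sub_eq_iff_eq_add.mp hx.symm
  rw [h, smul_add]
  abel

end Toric

/-! ## §3 TORIC ⟹ ORDINARY at every prime above an admissible `q`; the equivalence with g28's converse -/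

section ToricOrdinary

variable {K : Type} [Field K] [NumberField K] (W : WeierstrassCurve ℚ) [W.IsElliptic] [W.IsGloballyMinimal] {p : ℕ} [Fact p.Prime]
  (κ : ZpExtension K p)

/-- ★ **TORIC ⟹ ORDINARY at every Frobenius of every prime above `v`** (the converse of LEAD g28's `mem_toricLocalKer_of_forall_mem_ordinaryAt`): `q` a
Bertolini–Darmon `1`-admissible prime (only «good `v ∤ p`» is used), `v ∋ q`; if `X ∈ H¹(K, E[p])` is TORIC at `K_v` then its bottom-layer restriction
`T X` is `ordinaryAt 𝔓` for every prime `𝔓 ∣ v` of `K̄` — `res_{⟨φ⟩}(T X) = 0` for every arithmetic Frobenius `φ ∈ D_𝔓`.  Proof: a conjugate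
`φ₁ = τ φ τ⁻¹` is a Frobenius at `𝔓₁` (`exists_isArithFrobAt_conj_of_mem_primesAbove_holds`: transitivity + Mathlib `IsArithFrobAt.conj`); §2 gives
`ψ φ₁ = φ₁ a − a`; §1 transports to `ψ φ = φ b − b` and then to all of `⟨φ⟩`; `resOfLe_resH1Hom_layerZero_eq_zero_iff`.
So CHKLL25's `ordinaryAt` over an admissible prime IS Bertolini–Darmon's `H¹_ord` (READING `ord-via-Frobenius` of
`CastellaHsuKunduLeeLiu2025.SignedBipartiteEulerSystem`, now a kernel equivalence with §3's iff).
[cite: Howard2006, §2.2, Lem. 2.2.1] [cite: CastellaEtAl2025, §7.2 (arXiv:2308.10474v2 p0030 L22–L27)] [cite: BertoliniDarmon2005, §2.2–§2.3] -/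
theorem forall_mem_ordinaryAt_of_mem_toricLocalKer {q : ℕ}
    (hq : IsAdmissiblePrime (W.conductorNorm ℤ) K (fun ℓ ↦ W.frobeniusTrace ℓ) p 1 q)
    {v : HeightOneSpectrum (𝓞 K)} (hqv : ((q : ℕ) : 𝓞 K) ∈ v.asIdeal) (X : Vp W K p)
    (htor : X ∈ toricLocalKer (W.baseChange K) (v.adicCompletion K) ((p ^ 1 : ℕ) : ℤ)) :
    ∀ 𝔓 ∈ v.primesAbove,
      resH1Hom (Literature.NumberTheory.EllipticCurves.subgroupIncl (κ.layerSubgroup 0))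
          (AddSubgroup.inclusion (geomTorsion_natCast_pow_one W (K := K) (p := p)).le) (fun _ _ ↦ rfl) X ∈
        ordinaryAt (W.baseChange K) ((p : ℤ) ^ 1) (κ.layerSubgroup 0) 𝔓 := by
  have hp : p.Prime := Fact.out
  obtain ⟨hgood, hpv⟩ := hasGoodReductionAt_of_isAdmissiblePrime W K hq v hqv
  have hn : ((((p ^ 1 : ℕ) : ℤ)) : 𝓞 K) ∉ v.asIdeal := by rw [Int.cast_natCast, Nat.pow_one, ← Int.cast_natCast]; exact hpv
  obtain ⟨ψ, rfl⟩ := oneCocycleClass_surjective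
    (discreteTopRep (absoluteGaloisGroup K) (geomTorsion (W.baseChange K) ((p ^ 1 : ℕ) : ℤ))) X
  -- the reference prime `𝔓₁ = 𝔓_{ι₀,𝔐}`
  haveI : CharZero (v.adicCompletion K) :=
    charZero_of_injective_algebraMap (algebraMap K (v.adicCompletion K)).injective
  obtain ⟨𝔐, h𝔐⟩ := v.localPrimesAbove_nonempty
  set 𝔓₁ := v.primeBelow (closureEmb (K := K) (v.adicCompletion K)) 𝔐 with h𝔓₁def
  have h𝔓₁ : 𝔓₁ ∈ v.primesAbove := v.primeBelow_mem_primesAbove h𝔐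
  intro 𝔓 h𝔓
  haveI : 𝔓.IsPrime := h𝔓.1
  rw [mem_ordinaryAt_iff]
  intro φ hφ hφD hφF
  -- conjugate the Frobenius to the reference prime `𝔓₁` (Frobenii above `v` are conjugate)
  obtain ⟨τ, -, hφ₁⟩ := HeightOneSpectrum.exists_isArithFrobAt_conj_of_mem_primesAbove_holds h𝔓 h𝔓₁ hφF
  obtain ⟨a, ha⟩ := exists_apply_eq_coboundary_of_mem_toricLocalKer W hgood hn ψ htor h𝔐 hφ₁
  have hb := apply_conj_eq_of_apply_eq W ψ (τ := τ⁻¹) ha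
  have hconj : τ⁻¹ * (τ * φ * τ⁻¹) * τ⁻¹⁻¹ = φ := by group
  rw [hconj] at hb
  rw [resOfLe_resH1Hom_layerZero_eq_zero_iff]
  exact ⟨τ⁻¹ • a - ψ.1 τ⁻¹, fun s ↦ apply_eq_of_mem_zpowers_of_apply_eq W ψ hb s s.2⟩

/-- **TORIC ⟺ ORDINARY at every prime above an admissible `q`** (this file's §3 with LEAD g28's `mem_toricLocalKer_of_forall_mem_ordinaryAt`).
[cite: Howard2006, Lem. 2.2.1] [cite: BertoliniDarmon2005, §2.2–§2.3] -/
theorem forall_mem_ordinaryAt_iff_mem_toricLocalKer {q : ℕ}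
    (hq : IsAdmissiblePrime (W.conductorNorm ℤ) K (fun ℓ ↦ W.frobeniusTrace ℓ) p 1 q)
    {v : HeightOneSpectrum (𝓞 K)} (hqv : ((q : ℕ) : 𝓞 K) ∈ v.asIdeal) (X : Vp W K p) :
    (∀ 𝔓 ∈ v.primesAbove,
      resH1Hom (Literature.NumberTheory.EllipticCurves.subgroupIncl (κ.layerSubgroup 0))
          (AddSubgroup.inclusion (geomTorsion_natCast_pow_one W (K := K) (p := p)).le) (fun _ _ ↦ rfl) X ∈
        ordinaryAt (W.baseChange K) ((p : ℤ) ^ 1) (κ.layerSubgroup 0) 𝔓) ↔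
      X ∈ toricLocalKer (W.baseChange K) (v.adicCompletion K) ((p ^ 1 : ℕ) : ℤ) :=
  ⟨mem_toricLocalKer_of_forall_mem_ordinaryAt W κ hq hqv X, forall_mem_ordinaryAt_of_mem_toricLocalKer W κ hq hqv X⟩

end ToricOrdinary

/-! ## §4 The LEVEL-`n` DICTIONARY `Sel^ε_{∏s}(K_0, E[p]) = T({Kummer off s} ∩ {toric at s})` -/

section Dictionary

variable {K : Type} [Field K] [NumberField K] (W : WeierstrassCurve ℚ) [W.IsElliptic] [W.IsGloballyMinimal] {p : ℕ} [Fact p.Prime]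
  (κ : ZpExtension K p) {𝔭 𝔭' : HeightOneSpectrum (𝓞 K)}

omit [NumberField K] [W.IsElliptic] [Fact p.Prime] in
/-- The primes dividing a square-free product of admissible primes: `ℓ` prime with `ℓ ∣ ∏_{q ∈ s} q` and `ℓ ∈ v` iff some `q ∈ s` lies in `v`.
[folklore] -/
theorem exists_prime_dvd_prod_iff (s : Finset (AdmQ W K p)) (v : HeightOneSpectrum (𝓞 K)) :
    (∃ ℓ : ℕ, ℓ.Prime ∧ ℓ ∣ (∏ q ∈ s, (q : ℕ)) ∧ ((ℓ : ℕ) : 𝓞 K) ∈ v.asIdeal) ↔ ∃ q ∈ s, ((q : ℕ) : 𝓞 K) ∈ v.asIdeal := by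
  constructor
  · rintro ⟨ℓ, hℓ, hdvd, hℓv⟩
    obtain ⟨q, hq, hℓq⟩ := (Nat.Prime.prime hℓ).exists_mem_finset_dvd hdvd
    have hqprime : (q : ℕ).Prime := q.2.1
    rw [(Nat.prime_dvd_prime_iff_eq hℓ hqprime).mp hℓq] at hℓv
    exact ⟨q, hq, hℓv⟩
  · rintro ⟨q, hq, hqv⟩
    exact ⟨q, q.2.1, Finset.dvd_prod_of_mem _ hq, hqv⟩

/-- ★★ **THE LEVEL-`n` DICTIONARY.**  Under `AcSigned.Setting`, (Heeg) for `N_E`, the named print fact {HLV 2022 Lemma 3.7, local form} and the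
bad-place hypothesis (KU) «at every bad `v ∤ p`: unramified at every `𝔓 ∣ v` ⟺ Kummer at `v`» (shape of g29's `hbad`), for a finite set `s` of
Bertolini–Darmon admissible primes and a class `X ∈ H¹(K, E[p])`:
`T X ∈ Sel^ε_{∏s}(K_0, E[p])` (CHKLL25's bottom signed `∏s`-ordinary Selmer group `signedOrdSelmerTorsion (W⁄K) p κ ε (∏ s) 0 1`) IFF
(i) `X` satisfies E's Kummer condition at every finite place above NO prime of `s` and (ii) the TORIC condition at every place above a prime of `s`.
Place by place: `v ∣ p` — no admissible prime lies in `v`; the `±` control (`ctrl_iff_of_lemma37_local`); good `v ∤ p` off `s` — Gross (7.1)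
(`resH1Hom_layerZero_mem_unramifiedAt_iff_mem_selmerLocalKer`); bad `v ∤ p` — (KU) (admissible primes are good); `v ∋ q ∈ s` — §3's iff.
At `s = ∅` this is `…AdmdefRankOneDictionary.resH1Hom_layerZero_mem_signedOrdSelmerTorsion_one_iff_mem_selmerGroup` (up to the automatic archimedean
Kummer condition). [cite: CastellaEtAl2025, §7.2 (arXiv:2308.10474v2 p0030 L16–L27)] [cite: HatleyLeiVigni2022, Lemma 3.7 (proof)] [cite: GrossLMS1991, §7 (7.1)]
[cite: BertoliniDarmon2005, §2.2–§2.3] [cite: WZhang2014, §4.1, §5] -/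
theorem resH1Hom_layerZero_mem_signedOrdSelmerTorsion_iff (hS : Setting W K p κ 𝔭 𝔭')
    (hH : SatisfiesHeegnerHypothesis (W.conductorNorm ℤ) K) (hloc : hatleyLeiVigni2022_lemma37_local_signedCondition_eq_kummer W K p κ 𝔭 𝔭')
    (hbad : ∀ v : HeightOneSpectrum (𝓞 K), ¬ (W.baseChange K).HasGoodReductionAt v → ((p : ℕ) : 𝓞 K) ∉ v.asIdeal → ∀ X : Vp W K p,
      (∀ 𝔓 ∈ v.primesAbove, X ∈ unramifiedKer (geomTorsion (W.baseChange K) ((p ^ 1 : ℕ) : ℤ)) 𝔓) ↔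
        X ∈ selmerLocalKer (W.baseChange K) (v.adicCompletion K) ((p ^ 1 : ℕ) : ℤ))
    (ε : ℤˣ) (s : Finset (AdmQ W K p)) (X : Vp W K p) :
    resH1Hom (Literature.NumberTheory.EllipticCurves.subgroupIncl (κ.layerSubgroup 0))
        (AddSubgroup.inclusion (geomTorsion_natCast_pow_one W (K := K) (p := p)).le) (fun _ _ ↦ rfl) X ∈
        signedOrdSelmerTorsion (W.baseChange K) p κ ε (∏ q ∈ s, (q : ℕ)) 0 1 ↔
      (∀ v : HeightOneSpectrum (𝓞 K), (∀ q ∈ s, ((q : ℕ) : 𝓞 K) ∉ v.asIdeal) →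
        X ∈ selmerLocalKer (W.baseChange K) (v.adicCompletion K) ((p ^ 1 : ℕ) : ℤ)) ∧
      (∀ q ∈ s, ∀ v : HeightOneSpectrum (𝓞 K), ((q : ℕ) : 𝓞 K) ∈ v.asIdeal →
        X ∈ toricLocalKer (W.baseChange K) (v.adicCompletion K) ((p ^ 1 : ℕ) : ℤ)) := by
  have hp : p.Prime := Fact.out
  -- no admissible prime lies above `p`
  have hqp : ∀ (q : AdmQ W K p) (v : HeightOneSpectrum (𝓞 K)), ((q : ℕ) : 𝓞 K) ∈ v.asIdeal → ((p : ℕ) : 𝓞 K) ∉ v.asIdeal :=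
    fun q v hqv ↦ (hasGoodReductionAt_of_isAdmissiblePrime W K q.2 v hqv).2 |> fun h ↦ by
      rw [← Int.cast_natCast]; exact h
  -- admissible primes are good
  have hqgood : ∀ (q : AdmQ W K p) (v : HeightOneSpectrum (𝓞 K)), ((q : ℕ) : 𝓞 K) ∈ v.asIdeal → (W.baseChange K).HasGoodReductionAt v :=
    fun q v hqv ↦ (hasGoodReductionAt_of_isAdmissiblePrime W K q.2 v hqv).1
  rw [mem_signedOrdSelmerTorsion_iff]
  constructor
  · rintro ⟨habove, hord, hunr⟩
    refine ⟨fun v hv ↦ ?_, fun q hq v hqv ↦ ?_⟩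
    · by_cases hpv : ((p : ℕ) : 𝓞 K) ∈ v.asIdeal
      · exact ctrl_of_lemma37_local W κ hS hH hloc ε v hpv X (habove v hpv)
      · have hno : ¬ ∃ ℓ : ℕ, ℓ.Prime ∧ ℓ ∣ (∏ q ∈ s, (q : ℕ)) ∧ ((ℓ : ℕ) : 𝓞 K) ∈ v.asIdeal := by
          rw [exists_prime_dvd_prod_iff W]
          rintro ⟨q, hq, hqv⟩
          exact hv q hq hqv
        by_cases hgood : (W.baseChange K).HasGoodReductionAt v
        · obtain ⟨𝔓, h𝔓⟩ := HeightOneSpectrum.primesAbove_nonempty v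
          exact (resH1Hom_layerZero_mem_unramifiedAt_iff_mem_selmerLocalKer W κ hgood hpv h𝔓 X).mp (hunr v hpv hno 𝔓 h𝔓)
        · exact (hbad v hgood hpv X).mp fun 𝔓 h𝔓 ↦
            (resH1Hom_layerZero_mem_unramifiedAt_iff W κ 𝔓 X).mp (hunr v hpv hno 𝔓 h𝔓)
    · have hyes : ∃ ℓ : ℕ, ℓ.Prime ∧ ℓ ∣ (∏ q ∈ s, (q : ℕ)) ∧ ((ℓ : ℕ) : 𝓞 K) ∈ v.asIdeal :=
        (exists_prime_dvd_prod_iff W s v).mpr ⟨q, hq, hqv⟩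
      exact (forall_mem_ordinaryAt_iff_mem_toricLocalKer W κ q.2 hqv X).mp (hord v (hqp q v hqv) hyes)
  · rintro ⟨hkum, htor⟩
    refine ⟨fun v hpv ↦ ?_, fun v hpv hyes 𝔓 h𝔓 ↦ ?_, fun v hpv hno 𝔓 h𝔓 ↦ ?_⟩
    · -- `v ∣ p`: no `q ∈ s` lies in `v`, so `X` is Kummer at `v`; the easy control
      have hv : ∀ q ∈ s, ((q : ℕ) : 𝓞 K) ∉ v.asIdeal := fun q _ hqv ↦ hqp q v hqv hpv
      exact resH1Hom_layerZero_mem_condAboveTorsion_of_mem_selmerLocalKer W κ v ε X (hkum v hv)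
    · -- `v ∋ q ∈ s`: toric ⟹ ordinary (§3)
      obtain ⟨q, hq, hqv⟩ := (exists_prime_dvd_prod_iff W s v).mp hyes
      exact forall_mem_ordinaryAt_of_mem_toricLocalKer W κ q.2 hqv X (htor q hq v hqv) 𝔓 h𝔓
    · -- `v ∤ p` off `s`: Kummer ⟹ unramified
      have hv : ∀ q ∈ s, ((q : ℕ) : 𝓞 K) ∉ v.asIdeal := by
        intro q hq hqv
        exact hno ((exists_prime_dvd_prod_iff W s v).mpr ⟨q, hq, hqv⟩)
      by_cases hgood : (W.baseChange K).HasGoodReductionAt v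
      · exact (resH1Hom_layerZero_mem_unramifiedAt_iff_mem_selmerLocalKer W κ hgood hpv h𝔓 X).mpr (hkum v hv)
      · exact (resH1Hom_layerZero_mem_unramifiedAt_iff W κ 𝔓 X).mpr (((hbad v hgood hpv X).mpr (hkum v hv)) 𝔓 h𝔓)

/-- ★★ **THE LEVEL-`n` DICTIONARY ON THE ALL-RAMIFIED CELL** — (KU) discharged by g29–g30 (`kummer_iff_unramified_of_not_dvd_localTamagawaNumber` +
`not_dvd_localTamagawaNumber_of_allRamified`): under the `Setting`, (Heeg), {HLV 2022 Lemma 3.7 local}, `p ≥ 5`, `(N : ℤ) = N_E`, `(N, d_K) = 1` and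
binder (ii) «`E[p]` ramified at every `q ∣ N`», `T X ∈ Sel^ε_{∏s}(K_0, E[p]) ⟺ (Kummer off s) ∧ (toric at s)`.
[cite: CastellaEtAl2025, §7.2, Thm. 7.1 (ii)] [cite: HatleyLeiVigni2022, Lemma 3.7] [cite: SilvermanATAEC1994, Cor. IV.9.2(d)] -/
theorem resH1Hom_layerZero_mem_signedOrdSelmerTorsion_iff_of_allRamified (hS : Setting W K p κ 𝔭 𝔭')
    (hH : SatisfiesHeegnerHypothesis (W.conductorNorm ℤ) K) (hloc : hatleyLeiVigni2022_lemma37_local_signedCondition_eq_kummer W K p κ 𝔭 𝔭')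
    (h5 : 5 ≤ p) {N : ℕ} (hN : (N : ℤ) = W.conductorNorm ℤ) (hND : IsCoprime (N : ℤ) (NumberField.discr K))
    (hall : ∀ q : ℕ, q.Prime → q ∣ N → ∃ v' : HeightOneSpectrum (𝓞 ℚ), ((q : ℕ) : 𝓞 ℚ) ∈ v'.asIdeal ∧
      ∃ 𝔓 ∈ v'.primesAbove, ∃ σ ∈ 𝔓.inertia (absoluteGaloisGroup ℚ), ∃ P : W.geomTorsion (p : ℤ), σ • P ≠ P)
    (ε : ℤˣ) (s : Finset (AdmQ W K p)) (X : Vp W K p) :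
    resH1Hom (Literature.NumberTheory.EllipticCurves.subgroupIncl (κ.layerSubgroup 0))
        (AddSubgroup.inclusion (geomTorsion_natCast_pow_one W (K := K) (p := p)).le) (fun _ _ ↦ rfl) X ∈
        signedOrdSelmerTorsion (W.baseChange K) p κ ε (∏ q ∈ s, (q : ℕ)) 0 1 ↔
      (∀ v : HeightOneSpectrum (𝓞 K), (∀ q ∈ s, ((q : ℕ) : 𝓞 K) ∉ v.asIdeal) →
        X ∈ selmerLocalKer (W.baseChange K) (v.adicCompletion K) ((p ^ 1 : ℕ) : ℤ)) ∧
      (∀ q ∈ s, ∀ v : HeightOneSpectrum (𝓞 K), ((q : ℕ) : 𝓞 K) ∈ v.asIdeal →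
        X ∈ toricLocalKer (W.baseChange K) (v.adicCompletion K) ((p ^ 1 : ℕ) : ℤ)) :=
  resH1Hom_layerZero_mem_signedOrdSelmerTorsion_iff W κ hS hH hloc
    (kummer_iff_unramified_of_not_dvd_localTamagawaNumber W
      (not_dvd_localTamagawaNumber_of_allRamified W hS.isImaginaryQuadratic.1 (Fact.out : p.Prime) h5 hN hND hall)) ε s X

end Dictionary

end Summit.BirchSwinnertonDyer.BirchSwinnertonDyer.Theorems.SignedBaseChangeAcDivAdmdefToricOrdinary

end
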